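import Literature.Barriers.Parity.SiegelZeroDichotomyChowlaStep3Model
import Mathlib.Analysis.SpecialFunctions.Pow.Complex
import Mathlib.Analysis.SpecialFunctions.Trigonometric.Bounds
import Mathlib.Analysis.Complex.Exponential
import HarnessLib

/-!
# Step (iii) of Tao–Teräväinen at `k = 0`, local part: the twisted coefficients
# `β_t = (λ ∗ μχ)_(≤R) (·)^{s} ∗ χ` and their values at prime powers

Topic `Literature/Barriers/Parity`, sub-namespace `TaoTeravainen`; a file of the proof DAG of
`Literature.Barriers.Parity.TaoTeravainen2021_chowla`, towards `TaoTeravainen2021_prop63_k0`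
(Proposition 6.3 at `k = 0`). Everything here is PROVED.

In the proof of Lemma 6.1 the source inserts the Fourier representation (6.9) of `ψ_{>D}` into
`λ♭_Siegel = (λ ∗ μχ)_(≤R) ψ_{>D} ∗ χ` and obtains `∫ β_t f(t) dt` with the multiplicative
(6.11) "`β_t := (λ ∗ μχ)_(≤R) (·)^{(1+it)/log R} ∗ χ_(≤R)`", then computes `|β_t(p^j)|`:
"`|β_t(p^j)| = 1` when `p ≤ R` and `χ(p) = -1` (because `λ ∗ μχ` agrees with `λ ∗ μλ = 1_{{1}}` on
`ℕ_(p)`), and `|β_t(p^j)| = p^{j/log R}` when `p ≤ R` and `χ(p) = 0`. For `χ(p) = +1` … direct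
calculation gives `β_t(p^j) = P_j(p^{(1+it)/log R})` where `P_j(z) := 1 - 2z + 2z² - … + (-1)^j 2z^j`.
Note that `|P_j(1)| ≤ 1` … `|P_j(z)| ≤ 1 + O(|z-1| j^{O(1)})` … Also from the triangle inequality we
have `|P_j(z)| ≪ j |z|^j` for `|z| ≥ 1`." [cite: TaoTeravainen2021, §6 (6.11) and the following displays]

Here (we convolve with the full `χ` rather than `χ_(≤R)`, which only adds the harmless values
`β(p^j) = χ(p)^j` at primes `p > R` and makes `λ♭_Siegel(n) = ∫ β_t(n) f(t) dt` hold on the nose):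

* `powAF s`, `toComplexAF`, `betaAF χ N s := ((λ ∗ μχ)_(≤R) · (·)^s) ∗ χ` (complex arithmetic
  functions, `N = ⌊R⌋₊ + 1`), `betaAF_apply` (the divisor-sum form matching `liouvilleSiegelFlat`),
  `isMultiplicative_betaAF`;
* the prime-power values `betaAF_prime_pow` and the three bounds actually consumed downstream:
  `norm_betaAF_prime_pow_le_one` (`p > R`: `|β(p^j)| = |χ(p)|^j ≤ 1`),
  `norm_betaAF_prime_pow_le` (`|β(p^j)| ≤ (2j+1) p^{j Re s}`, the bound `|P_j(z)| ≪ j|z|^j`), and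
  `norm_betaAF_prime_le` (`|β(p)| ≤ 1 + 2|p^s - 1|`, the bound `|P_1(z)| ≤ 1 + O(|z - 1|)`);
* `norm_cpow_sub_one_le` — `|p^s - 1| ≤ (2 Re s + |Im s|) log p` when `0 ≤ Re s`, `(Re s) log p ≤ 1`
  (so `|z - 1| ≪ (1+|t|) log_R p` for `z = p^{(1+it)/log R}`, `p ≤ R`).

NOT here: the averaging over `n` (Euler products, Mertens) and the `t`-integration — see the sequels.
-/

noncomputable section

open Finset ArithmeticFunction Complex

namespace Literature.Barriers.Parity.TaoTeravainen

variable {q : ℕ} (χ : DirichletCharacter ℂ q)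

/-! ### Complex arithmetic functions: `n^s`, complexification, `β` -/

/-- `n ↦ n^s` as a complex arithmetic function (`0 ↦ 0`). [folklore] -/
def powAF (s : ℂ) : ArithmeticFunction ℂ :=
  ⟨fun n => if n = 0 then 0 else (n : ℂ) ^ s, if_pos rfl⟩

/-- `powAF s n = n^s` for `n ≠ 0`. [folklore] -/
theorem powAF_apply (s : ℂ) {n : ℕ} (hn : n ≠ 0) : powAF s n = (n : ℂ) ^ s := by
  simp [powAF, hn]

/-- `n ↦ n^s` is (completely) multiplicative. [folklore] -/
theorem isMultiplicative_powAF (s : ℂ) : (powAF s).IsMultiplicative := by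
  refine ⟨by simp [powAF], fun {m n} _ => ?_⟩
  rcases eq_or_ne m 0 with rfl | hm
  · simp [powAF]
  rcases eq_or_ne n 0 with rfl | hn
  · simp [powAF]
  rw [powAF_apply s (mul_ne_zero hm hn), powAF_apply s hm, powAF_apply s hn, Nat.cast_mul]
  exact Complex.natCast_mul_natCast_cpow m n s

/-- Complexification of a real arithmetic function. (Same three-line construction as
`Literature.NumberTheory.Sieve.MatomakiRadziwillL4A.toComplexAF`, whose file carries the unrelated
Granville–Soundararajan / Matomäki–Radziwiłł import closure; repeated here to keep the imports of
this proof DAG light.) [folklore] -/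
def toComplexAF (f : ArithmeticFunction ℝ) : ArithmeticFunction ℂ :=
  ⟨fun n => (f n : ℂ), by simp⟩

/-- `toComplexAF f n = f n`. [folklore] -/
@[simp] theorem toComplexAF_apply (f : ArithmeticFunction ℝ) (n : ℕ) : toComplexAF f n = (f n : ℂ) := rfl

/-- Complexification preserves multiplicativity. [folklore] -/
theorem IsMultiplicative.toComplexAF {f : ArithmeticFunction ℝ} (hf : f.IsMultiplicative) :
    (toComplexAF f).IsMultiplicative :=
  ⟨by simp [hf.map_one], fun {m n} hmn => by simp [hf.map_mul_of_coprime hmn]⟩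

/-- **The twisted coefficients** `β_s := ((λ ∗ μχ)_(≤R) · (·)^s) ∗ χ` ((6.11) with `χ` for
`χ_(≤R)`), as a complex arithmetic function; `N = ⌊R⌋₊ + 1`, `s = (1 + 2πit)/log R` in the
application. [cite: TaoTeravainen2021, §6 (6.11)] -/
def betaAF (N : ℕ) (s : ℂ) : ArithmeticFunction ℂ :=
  ((toComplexAF (siegelCoeffAF χ N)).pmul (powAF s)) * toComplexAF (chiAF χ)

/-- The divisor-sum form of `β_s(n)` (matching `liouvilleSiegelFlat`): for `n ≥ 1`,
`β_s(n) = ∑_{de = n} 1_{ℕ_(≤R)}(d) (λ ∗ μχ)(d) d^s χ(e)`. [cite: TaoTeravainen2021, §6 (6.11)] -/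
theorem betaAF_apply (N : ℕ) (s : ℂ) (n : ℕ) :
    betaAF χ N s n = ∑ p ∈ n.divisorsAntidiagonal,
      ((if p.1 ∈ N.smoothNumbers then lamMuChi χ p.1 else 0 : ℝ) : ℂ) * (p.1 : ℂ) ^ s *
        (realChar χ p.2 : ℂ) := by
  rw [betaAF, mul_apply]
  refine sum_congr rfl fun p hp => ?_
  obtain ⟨h1, h2⟩ := Nat.mem_divisorsAntidiagonal.mp hp
  have hp1 : p.1 ≠ 0 := left_ne_zero_of_mul (h1 ▸ h2)
  have hp2 : p.2 ≠ 0 := right_ne_zero_of_mul (h1 ▸ h2)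
  rw [pmul_apply, toComplexAF_apply, toComplexAF_apply, siegelCoeffAF_apply, powAF_apply s hp1,
    chiAF_apply χ hp2]

/-- `β_s` is multiplicative (for quadratic `χ`). [cite: TaoTeravainen2021, §6 (after (6.11))] -/
theorem isMultiplicative_betaAF (hχ : χ.IsQuadratic) (N : ℕ) (s : ℂ) :
    (betaAF χ N s).IsMultiplicative :=
  ((IsMultiplicative.toComplexAF (isMultiplicative_siegelCoeffAF χ hχ N)).pmul
    (isMultiplicative_powAF s)).mul (IsMultiplicative.toComplexAF (isMultiplicative_chiAF χ hχ))

/-! ### Values at prime powers -/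

/-- `β_s(pᵏ) = ∑_{0 ≤ i ≤ k} g(pⁱ) (pⁱ)^s χ(p)^{k-i}`. [cite: TaoTeravainen2021, §6 ("direct calculation")] -/
theorem betaAF_prime_pow (hχ : χ.IsQuadratic) (N : ℕ) (s : ℂ) {p : ℕ} (hp : p.Prime) (k : ℕ) :
    betaAF χ N s (p ^ k) = ∑ i ∈ range (k + 1),
      (siegelCoeffAF χ N (p ^ i) : ℂ) * ((p ^ i : ℕ) : ℂ) ^ s * (realChar χ p : ℂ) ^ (k - i) := by
  rw [betaAF, mul_apply, Nat.sum_divisorsAntidiagonal fun a b =>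
    ((toComplexAF (siegelCoeffAF χ N)).pmul (powAF s)) a * toComplexAF (chiAF χ) b,
    Nat.divisors_prime_pow hp, Finset.sum_map]
  refine sum_congr rfl fun i hi => ?_
  simp only [Function.Embedding.coeFn_mk]
  rw [Nat.pow_div (Nat.lt_succ_iff.mp (mem_range.mp hi)) hp.pos, pmul_apply, toComplexAF_apply,
    toComplexAF_apply, powAF_apply s (pow_ne_zero _ hp.ne_zero),
    chiAF_apply χ (pow_ne_zero _ hp.ne_zero), realChar_pow χ hχ, Complex.ofReal_pow]

/-- `|χ(p)| ≤ 1` in `ℂ`. [folklore] -/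
theorem norm_realChar_le_one (p : ℕ) : ‖(realChar χ p : ℂ)‖ ≤ 1 := by
  rw [Complex.norm_real, Real.norm_eq_abs]
  exact abs_realChar_le_one χ p

/-- `|g(pⁱ)| ≤ 2`. [cite: TaoTeravainen2021, §6 (proof of Lemma 6.1)] -/
theorem norm_siegelCoeffAF_prime_pow_le (N : ℕ) {p : ℕ} (hp : p.Prime) {i : ℕ} (hi : i ≠ 0) :
    ‖(siegelCoeffAF χ N (p ^ i) : ℂ)‖ ≤ 2 := by
  rw [siegelCoeffAF_apply_prime_pow χ N hp hi, Complex.norm_real, Real.norm_eq_abs]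
  split_ifs
  · rw [abs_mul, abs_pow, abs_neg, abs_one, one_pow, one_mul]
    have := abs_realChar_le_one χ p
    rw [abs_le] at this ⊢
    constructor <;> linarith
  · simp

/-- `‖(pⁱ)^s‖ = p^{i Re s}`. [folklore] -/
theorem norm_natCast_pow_cpow {p : ℕ} (hp : 0 < p) (i : ℕ) (s : ℂ) :
    ‖((p ^ i : ℕ) : ℂ) ^ s‖ = (p : ℝ) ^ ((i : ℝ) * s.re) := by
  rw [Complex.norm_natCast_cpow_of_pos (pow_pos hp i), Nat.cast_pow, Real.rpow_mul (by positivity),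
    Real.rpow_natCast]

/-- **`p > R`**: `β_s(pᵏ) = χ(p)ᵏ`, so `|β_s(pᵏ)| ≤ 1`. [cite: TaoTeravainen2021, §6 (6.11)] -/
theorem norm_betaAF_prime_pow_le_one (hχ : χ.IsQuadratic) {N : ℕ} (s : ℂ) {p : ℕ} (hp : p.Prime)
    (hpN : N ≤ p) (k : ℕ) : ‖betaAF χ N s (p ^ k)‖ ≤ 1 := by
  rw [betaAF_prime_pow χ hχ N s hp, Finset.sum_range_succ', Finset.sum_eq_zero fun i _ => by
    rw [siegelCoeffAF_apply_prime_pow χ N hp (Nat.succ_ne_zero i), if_neg (by omega)]; simp]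
  rw [zero_add, pow_zero, (isMultiplicative_siegelCoeffAF χ hχ N).map_one, Nat.cast_one,
    Complex.one_cpow, Nat.sub_zero, Complex.ofReal_one, one_mul, one_mul, norm_pow]
  exact pow_le_one₀ (norm_nonneg _) (norm_realChar_le_one χ p)

/-- **`|β_s(pᵏ)| ≤ (2k + 1) p^{k Re s}`** for `Re s ≥ 0` (all primes; the source's `|P_j(z)| ≪ j |z|^j`
together with the cases `χ(p) ∈ {0, -1}` and `p > R`). [cite: TaoTeravainen2021, §6 (proof of Lemma 6.1)] -/
theorem norm_betaAF_prime_pow_le (hχ : χ.IsQuadratic) (N : ℕ) {s : ℂ} (hs : 0 ≤ s.re) {p : ℕ}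
    (hp : p.Prime) (k : ℕ) :
    ‖betaAF χ N s (p ^ k)‖ ≤ (2 * k + 1) * (p : ℝ) ^ ((k : ℝ) * s.re) := by
  have hp1 : (1 : ℝ) ≤ p := by exact_mod_cast hp.one_lt.le
  have hP : 1 ≤ (p : ℝ) ^ ((k : ℝ) * s.re) := Real.one_le_rpow hp1 (by positivity)
  rw [betaAF_prime_pow χ hχ N s hp, Finset.sum_range_succ']
  rw [pow_zero, (isMultiplicative_siegelCoeffAF χ hχ N).map_one, Nat.cast_one, Complex.one_cpow,
    Nat.sub_zero, Complex.ofReal_one, one_mul, one_mul]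
  have hterm : ∀ i ∈ range k, ‖(siegelCoeffAF χ N (p ^ (i + 1)) : ℂ) * ((p ^ (i + 1) : ℕ) : ℂ) ^ s *
      (realChar χ p : ℂ) ^ (k - (i + 1))‖ ≤ 2 * (p : ℝ) ^ ((k : ℝ) * s.re) := by
    intro i hi
    have hik : i + 1 ≤ k := mem_range.mp hi
    rw [norm_mul, norm_mul, norm_pow, norm_natCast_pow_cpow hp.pos]
    calc ‖(siegelCoeffAF χ N (p ^ (i + 1)) : ℂ)‖ * (p : ℝ) ^ (((i + 1 : ℕ) : ℝ) * s.re) *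
          ‖(realChar χ p : ℂ)‖ ^ (k - (i + 1))
        ≤ 2 * (p : ℝ) ^ ((k : ℝ) * s.re) * 1 := by
          have h1 := norm_siegelCoeffAF_prime_pow_le χ N hp (Nat.succ_ne_zero i)
          have h2 : (p : ℝ) ^ (((i + 1 : ℕ) : ℝ) * s.re) ≤ (p : ℝ) ^ ((k : ℝ) * s.re) :=
            Real.rpow_le_rpow_of_exponent_le hp1
              (mul_le_mul_of_nonneg_right (by exact_mod_cast hik : ((i + 1 : ℕ) : ℝ) ≤ (k : ℝ)) hs)
          have h3 := pow_le_one₀ (n := k - (i + 1)) (norm_nonneg _) (norm_realChar_le_one χ p)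
          exact mul_le_mul (mul_le_mul h1 h2 (by positivity) (by norm_num)) h3 (by positivity)
            (by positivity)
      _ = 2 * (p : ℝ) ^ ((k : ℝ) * s.re) := mul_one _
  calc ‖∑ i ∈ range k, (siegelCoeffAF χ N (p ^ (i + 1)) : ℂ) * ((p ^ (i + 1) : ℕ) : ℂ) ^ s *
          (realChar χ p : ℂ) ^ (k - (i + 1)) + (realChar χ p : ℂ) ^ k‖
      ≤ ∑ i ∈ range k, ‖(siegelCoeffAF χ N (p ^ (i + 1)) : ℂ) * ((p ^ (i + 1) : ℕ) : ℂ) ^ s *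
          (realChar χ p : ℂ) ^ (k - (i + 1))‖ + ‖(realChar χ p : ℂ) ^ k‖ :=
        (norm_add_le _ _).trans (add_le_add (norm_sum_le _ _) le_rfl)
    _ ≤ ∑ _i ∈ range k, 2 * (p : ℝ) ^ ((k : ℝ) * s.re) + 1 := by
        gcongr with i hi
        · exact hterm i hi
        · rw [norm_pow]; exact pow_le_one₀ (norm_nonneg _) (norm_realChar_le_one χ p)
    _ = 2 * k * (p : ℝ) ^ ((k : ℝ) * s.re) + 1 := by rw [sum_const, card_range, nsmul_eq_mul]; ring
    _ ≤ (2 * k + 1) * (p : ℝ) ^ ((k : ℝ) * s.re) := by nlinarith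

/-- **`|β_s(p)| ≤ 1 + 2 |p^s - 1|`** (all primes; for `p ≤ R`, `β_s(p) = χ(p) - (1 + χ(p)) p^s
= -1 - (1 + χ(p))(p^s - 1)`, the source's `|P_1(z)| ≤ 1 + O(|z - 1|)`; for `p > R`, `β_s(p) = χ(p)`).
[cite: TaoTeravainen2021, §6 (proof of Lemma 6.1)] -/
theorem norm_betaAF_prime_le (hχ : χ.IsQuadratic) (N : ℕ) (s : ℂ) {p : ℕ} (hp : p.Prime) :
    ‖betaAF χ N s p‖ ≤ 1 + 2 * ‖(p : ℂ) ^ s - 1‖ := by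
  have h := betaAF_prime_pow χ hχ N s hp 1
  rw [pow_one] at h
  rw [h, Finset.sum_range_succ, Finset.sum_range_one, siegelCoeffAF_apply_prime_pow χ N hp one_ne_zero]
  simp only [pow_zero, pow_one, Nat.sub_zero, Nat.sub_self, (isMultiplicative_siegelCoeffAF χ hχ N).map_one,
    Complex.ofReal_one, Nat.cast_one, Complex.one_cpow, one_mul, mul_one]
  have hc : ‖(realChar χ p : ℂ)‖ ≤ 1 := norm_realChar_le_one χ p
  have hc2 : ‖(1 + (realChar χ p : ℂ))‖ ≤ 2 := (norm_add_le _ _).trans (by rw [norm_one]; linarith)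
  split_ifs with hpN
  · set c : ℂ := (realChar χ p : ℂ) with hc_def
    set z : ℂ := (p : ℂ) ^ s with hz_def
    have hrw : c + (((-1 : ℝ) * (1 + realChar χ p) : ℝ) : ℂ) * z = -1 - (1 + c) * (z - 1) := by
      push_cast
      rw [← hc_def]
      ring
    calc ‖c + (((-1 : ℝ) * (1 + realChar χ p) : ℝ) : ℂ) * z‖ = ‖-1 - (1 + c) * (z - 1)‖ := by rw [hrw]
      _ ≤ ‖(-1 : ℂ)‖ + ‖(1 + c) * (z - 1)‖ := norm_sub_le _ _
      _ = 1 + ‖1 + c‖ * ‖z - 1‖ := by rw [norm_neg, norm_one, norm_mul]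
      _ ≤ 1 + 2 * ‖z - 1‖ := by gcongr
  · rw [Complex.ofReal_zero, zero_mul, add_zero]
    linarith [norm_nonneg ((p : ℂ) ^ s - 1)]

/-! ### `|p^s - 1| ≪ (Re s + |Im s|) log p` -/

/-- **`|x^s - 1| ≤ (2 Re s + |Im s|) log x`** for real `x ≥ 1` and `0 ≤ Re s`, `(Re s) log x ≤ 1`:
`x^s = e^{a log x} e^{i b log x}`, `|e^{a log x} - 1| ≤ 2 a log x`, `|e^{iθ} - 1| ≤ |θ|`. With
`s = (1 + 2πit)/log R` and `p ≤ R` this is the source's `|z - 1| ≪ (1 + |t|) log_R p`.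
[cite: TaoTeravainen2021, §6 (proof of Lemma 6.1, the bound for `P_j`)] -/
theorem norm_cpow_sub_one_le {x : ℝ} (hx : 1 ≤ x) {s : ℂ} (hs : 0 ≤ s.re)
    (hsx : s.re * Real.log x ≤ 1) :
    ‖(x : ℂ) ^ s - 1‖ ≤ (2 * s.re + |s.im|) * Real.log x := by
  have hx0 : (0 : ℝ) < x := by linarith
  have hl : 0 ≤ Real.log x := Real.log_nonneg hx
  set ℓ := Real.log x with hℓ
  have hcpow : (x : ℂ) ^ s = Complex.exp ((ℓ * s.re : ℝ) : ℂ) * Complex.exp (Complex.I * (ℓ * s.im : ℝ)) := by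
    rw [Complex.cpow_def_of_ne_zero (by exact_mod_cast hx0.ne'), ← Complex.exp_add,
      ← Complex.ofReal_log hx0.le]
    congr 1
    apply Complex.ext <;> simp [hℓ]
  set E₁ := Complex.exp ((ℓ * s.re : ℝ) : ℂ)
  set E₂ := Complex.exp (Complex.I * (ℓ * s.im : ℝ))
  have hE₂ : ‖E₂‖ = 1 := Complex.norm_exp_I_mul_ofReal _
  have h1 : ‖E₁ - 1‖ ≤ 2 * (ℓ * s.re) := by
    have : E₁ - 1 = ((Real.exp (ℓ * s.re) - 1 : ℝ) : ℂ) := by simp [E₁]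
    rw [this, Complex.norm_real, Real.norm_eq_abs]
    have hle : |ℓ * s.re| ≤ 1 := by rw [abs_of_nonneg (by positivity)]; linarith [mul_comm ℓ s.re]
    calc |Real.exp (ℓ * s.re) - 1| ≤ 2 * |ℓ * s.re| := Real.abs_exp_sub_one_le hle
      _ = 2 * (ℓ * s.re) := by rw [abs_of_nonneg (by positivity)]
  have h2 : ‖E₂ - 1‖ ≤ ℓ * |s.im| := by
    calc ‖E₂ - 1‖ ≤ ‖ℓ * s.im‖ := Real.norm_exp_I_mul_ofReal_sub_one_le
      _ = ℓ * |s.im| := by rw [Real.norm_eq_abs, abs_mul, abs_of_nonneg hl]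
  calc ‖(x : ℂ) ^ s - 1‖ = ‖(E₁ - 1) * E₂ + (E₂ - 1)‖ := by rw [hcpow]; ring_nf
    _ ≤ ‖E₁ - 1‖ * ‖E₂‖ + ‖E₂ - 1‖ := (norm_add_le _ _).trans (by rw [norm_mul])
    _ ≤ 2 * (ℓ * s.re) * 1 + ℓ * |s.im| := by rw [hE₂]; gcongr
    _ = (2 * s.re + |s.im|) * ℓ := by ring

end Literature.Barriers.Parity.TaoTeravainen
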